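import Literature.MathematicalPhysics.QuantumFieldTheory.Balaban1983to89.InfiniteVolumeSufficientXX
import Literature.MathematicalPhysics.QuantumLattice.GaugeGroupsProofs
import HarnessLib

/-!
# Sufficient conditions for the infinite-volume limit, XXI — `SU(2)`: WORD TRACES SEPARATE ORBITS, HENCE
# `(3a) ⟺ (W-corr) ⟺ (W-single)` WITH NO DENSITY HYPOTHESIS

Angle (cell pub-balaban, part IR-1): volume-uniform observable bounds / the infinite-volume limit — what uniformity
in the volume the published bounds do and do not give, and THE EXACT MISSING ESTIMATE.  This module is sorry-free
and cites only published theorems; nothing from the manuscripts under audit is used.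

## Where modules XIX–XX left the question

* XIX (`hasUniqueInfiniteVolumeLimit_iff_hasWilsonLoopCorrelationLimits`): for a compact second-countable `G` and a
  continuous `ρ`, `(3a)` "the torus states have a unique infinite-volume limit" (`HasUniqueInfiniteVolumeLimit`) is
  EQUIVALENT to `(W-corr)` "every finite Wilson-loop correlation `⟨∏ᵢ Re/Im tr ρ(U_{ℓᵢ})⟩_{𝕋_{L+1},β}` converges
  as `L → ∞`" (`HasWilsonLoopCorrelationLimits`) — UNDER the density hypothesis `SpansGaugeInvariantCylinders d
  (wilsonLoopProducts ρ d)` (Lévy 2004, Thm 3.1, arXiv:math-ph/0306059 p.5: «Let `G` be a finite product of groups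
  among `U(n), SU(n), O(n), SO(n), Sp(n)`. Let `Γ = (E, V)` be a graph. Then the algebra generated by the Wilson
  loops is dense in the space of continuous functions on `C^G_Γ = G^E/G^V`.», transported to `ℤ^d`).
* XX (`spansGaugeInvariantCylinders_of_traceWordsDense`): that density hypothesis on `ℤ^d`, in every dimension,
  follows from a purely group-theoretic several-variable schema `TraceWordsDense ρ` (polynomials in the word traces
  `Re/Im tr ρ(w(V₁,…,V_r))` are uniformly dense in the continuous diagonally-conjugation-invariant functions on
  `G^r`), and the schema was DISCHARGED only when the character of `ρ` separates points
  (`traceWordsDense_of_trace_injective`; `U(1)`), leaving `(h : TraceWordsDense ρ)` as the one remaining input for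
  `SU(N)`, `N ≥ 2` (XX header and census item (f): "the first fundamental theorem of invariant theory").

## What this module proves (kernel-checked; `G = SU(2) = Matrix.specialUnitaryGroup (Fin 2) ℂ`, `ρ = fundamentalRep (Fin 2)`)

PART C (any compact `G`, continuous `ρ`).  `TraceWordsDense ρ` follows from the algebraic ORBIT-SEPARATION schema
`TraceWordsSeparateOrbits ρ` := "for every finite `ι` and `V, W : ι → G`: if `Re tr ρ(w(V)) = Re tr ρ(w(W))` and
`Im tr ρ(w(V)) = Im tr ρ(w(W))` for every word `w` in the letters `i^{±1}`, then `W = g V g⁻¹` for one `g ∈ G`"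
(`traceWordsDense_of_traceWordsSeparateOrbits`).  Proof = real Stone–Weierstrass
(`ContinuousMap.exists_mem_subalgebra_near_continuous_of_separatesPoints`) on the compact range `Y ⊆ ℝ^J` of the
word-trace map `Φ(V) = (Re/Im tr ρ(w(V)))_{w,b}`: `Φ : G^ι → Y` is a closed continuous surjection, hence a quotient
map; an invariant continuous `f` is constant on its fibres (= orbits, by separation), so `f = f̄ ∘ Φ` with `f̄`
continuous; the coordinates separate the points of `Y`; pull the approximating polynomial back along `Φ`.  This is
the shape of Lévy's own reduction (proof of Prop. 3.6, p.5: «Hence, Wilson loops separate the points on the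
configuration space. Since this space is compact, the result follows by the Stone-Weierstrass theorem.»), with the
conclusion of his Prop. 3.4 (p.5: «If `g` and `g'` are two points of `G^r` such that for all word `w` in `r` letters
and their inverses, the elements `w(g)` and `w(g')` of `G` are conjugate, then `g` and `g'` belong to the same
diagonal conjugacy class.») as the HYPOTHESIS.  `TraceWordsSeparateOrbits ρ` is the ONE-REPRESENTATION form of that
hypothesis (equal `ρ`-traces of all words, instead of conjugacy of all `w(g), w(g')`); for `SU(2)` the two agree
(`su2_exists_common_diag`: equal trace ⇒ conjugate), and for the defining representation of `U(n)` / `SU(n)` the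
schema is verbatim the hypothesis actually used in the proof of Sengupta 1994 Thm 2 (Proc. AMS 121, p.900: «The
hypothesis implies that the trace of the product g_{i_1} ⋯ g_{i_k} equals the trace of g'_{i_1} ⋯ g'_{i_k} for every
positive integer k and every i_1, …, i_k ∈ {1, …, m}. It is only this apparently weaker hypothesis that will be
used.»; conclusion «there is an element y ∈ G such that g'_a = y g_a y⁻¹ for every a ∈ I»).  The schema SUBSUMES
module XX's (`traceWordsSeparateOrbits_of_trace_injective`).

PART D (`SU(2)`).  `traceWordsSeparateOrbits_su2 : TraceWordsSeparateOrbits (fundamentalRep (Fin 2))` — PROVED by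
`2 × 2` matrix algebra on the first row `(U₀₀, U₀₁)` (`U₁₀ = -conj U₀₁`, `U₁₁ = conj U₀₀`, `|U₀₀|² + |U₀₁|² = 1`),
using ONLY the real traces of the POSITIVE words `[i]`, `[i₀ i]`, `[i₁ i]`, `[i₀ i₁ i]` of length `≤ 3`:
Case A (every `Re (V i)₀₀ = ±1`): all `V i = W i = ±1`.  Case B (some `V i₀` non-central): bring `V i₀` and `W i₀`
(same trace) to a COMMON diagonal `D = diag(λ, λ̄)`, `Im λ ≠ 0`, by the tree's spectral theorem
`exists_conj_eq_diagonal` and the signed swap `sSwap 0 1`; then `Re z = Re z'` and `Re(λz) = Re(λz')` force `z = z'`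
(`complex_eq_of_re_eq_of_re_mul_eq`), which with the words `[i], [i₀ i]` gives `(V i)₀₀ = (W i)₀₀` for all `i`,
hence `|(V i)₀₁| = |(W i)₀₁|`; a diagonal `T = diag(τ, τ̄)` with `τ² = (W i₁)₀₁/(V i₁)₀₁` (`ℂ` algebraically closed;
conjugation by `T` fixes `U₀₀` and multiplies `U₀₁` by `τ²`) matches one off-diagonal letter `i₁`, and the words
`[i₁ i], [i₀ i₁ i]` then force `V i = W i` for every `i`.  The invariant theory behind it is classical (Fricke–Klein–
Vogt: traces of words of length `≤ 3` coordinatise pairs in `SL₂`; Procesi 1976 for `n`-tuples of matrices); the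
statement is the `SU(2)`, one-representation case of Lévy's Prop. 3.4.

PART B (`SU(2)`).  The Fricke identity `tr(AB) + tr(A·adj B) = tr A · tr B` for `2 × 2` matrices
(`trace_mul_add_trace_mul_adjugate`, any commutative ring) gives in `SU(2)` `tr g · tr h = tr(gh) + tr(gh⁻¹)`
(`su2_trace_mul_add_trace_mul_inv`) and the traces are REAL (`su2_trace : tr U = 2 Re U₀₀`): the product-to-sum
formula `tracePart_mul_tracePart_su2`.  PART A turns any such formula into "the span of the Wilson-loop PRODUCTS is
the span of the SINGLE Wilson loops" (`span_wilsonLoopProducts_le_span_loopFactor_of_prod`, the proof of module XX's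
one-dimensional `span_wilsonLoopProducts_le_span_loopFactor` with the formula as hypothesis), so for `SU(2)` even the
SINGLE loops are dense (`spansGaugeInvariantCylinders_loopFactor_su2`) — correcting the expectation recorded in the
cell's census (`ir/SUFFICIENT.md` §24 (b), §25.3 (c), §25.5) that single loops should NOT suffice for `N ≥ 2`: for
`N = 2` they do (nothing is claimed either way for `N ≥ 3`).

PART E — HEADLINES (every dimension `d`, every real `β`):
* `hasUniqueInfiniteVolumeLimit_iff_hasWilsonLoopCorrelationLimits_su2` : `(3a) ⟺ (W-corr)`;
* `hasUniqueInfiniteVolumeLimit_iff_hasWilsonLoopLimits_su2` : `(3a) ⟺ (W-single)` (`HasWilsonLoopLimits`, XX);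
* `hasWilsonLoopCorrelationLimits_iff_hasWilsonLoopLimits_su2` : `(W-corr) ⟺ (W-single)`;
* `hasUniqueInfiniteVolumeLimit_su2_iff_cauchySeq` : `(3a)` IFF for every lattice loop `ℓ ⊂ ℤ^d` the real sequence
  `L ↦ ⟨Re tr U(ℓ)⟩_{𝕋_{L+1},β}` is CAUCHY (the `Im tr` loops vanish identically, `loopFactor_false_su2`).
So for `SU(2)` THE EXACT MISSING ESTIMATE between volume-uniform bounds and the infinite-volume limit is, loop by
loop, `|⟨Re tr U(ℓ)⟩_{𝕋_L,β} − ⟨Re tr U(ℓ)⟩_{𝕋_{L'},β}| → 0` (`L, L' → ∞`): a bound on single Wilson-loop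
expectations UNIFORM in `L` (which `|Re tr U(ℓ)| ≤ 2` gives for free) is not it; CONVERGENCE in `L` is, and nothing
more is needed.

PART F — CENSUS NEGATIVE.  `not_traceWordsSeparateOrbits_so2Rep`: the schema fails for the faithful real
representation `so2Rep` of `U(1)` (module XX; `z` and `z⁻¹` have equal word traces and are not conjugate in an
abelian group), so neither faithfulness nor continuity of `ρ` can replace orbit separation.

## Not claimed

Nothing for `SU(N)`, `N ≥ 3` (orbit separation there needs words of unbounded length and the first fundamental
theorem — in print as Sengupta 1994 Thm 2 p.900 / Lévy 2004 Prop. 3.4 / Procesi 1976, not kernel-proved here; with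
`(h : TraceWordsSeparateOrbits (fundamentalRep (Fin N)))` as hypothesis, PART C gives `(3a) ⟺ (W-corr)` for every
`N`); no Wilson-loop expectation is shown to converge at any `β`; no statement of the audited manuscripts is used or
assessed.  Cell records: `ir/SUFFICIENT.md` §26 (PART I, addendum 20).

VERSIONS: v1 (gen 21, p192365).  v1.1 (gen 21): docstrings only — the schema `TraceWordsSeparateOrbits` and
`traceWordsSeparateOrbits_su2` placed against the print form of Sengupta 1994 Thm 2 (p.900, quoted), header PART C /
"Not claimed" accordingly; no declaration changed.  v1.2 (gen 21): DOCFIX D-XXI-1 (XREAD C-strat19-1, LOW): the docstring of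
`traceWordsDense_of_traceWordsSeparateOrbits` attributed the Stone–Weierstrass sentence to the proof of Prop. 3.5 — it is
in the proof of Prop. 3.6 (p.5); locator and tag corrected; no declaration changed.
-/

namespace Literature.MathematicalPhysics.QuantumFieldTheory

open MeasureTheory Filter Topology
open scoped Pointwise
open Literature.MathematicalPhysics.QuantumLattice
open Literature.Probability.LatticeModels (Torus.proj zdGraph zdGraph_reachable)
open Balaban1983to89.Missing (SpansGaugeInvariantCylinders HasWilsonLoopCorrelationLimits TraceWordsDense
  HasWilsonLoopLimits)

-- Sites of `ℤ^d` are written `Fin d → ℤ`; `SU(2)` is written `Matrix.specialUnitaryGroup (Fin 2) ℂ` throughout and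
-- its defining representation is the tree's `fundamentalRep (Fin 2)` (`fundamentalRep_apply : fundamentalRep n U = ↑U`).

/-! ## PART A — A PRODUCT-TO-SUM FORMULA FOR THE CHARACTER MAKES THE SINGLE LOOPS SPAN THE LOOP ALGEBRA -/

section ProductToSum

variable {d N : ℕ} {G : Type*} [Group G] (ρ : G →* Matrix (Fin N) (Fin N) ℂ)

/-- **Product-to-sum ⇒ products of two generators are combinations of single generators.**  If the real and
imaginary parts of the character of `ρ` satisfy a product-to-sum formula
`χ_{b₁}(g) χ_{b₂}(h) = c₁ χ_b(gh) + c₂ χ_b(gh⁻¹)` (module XX `tracePart_mul_tracePart` for one-dimensional unitary `ρ`;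
`tracePart_mul_tracePart_su2` below for `SU(2)`), then the product of two Wilson-loop generators is a real combination
of two single generators (transport the second loop to the base point of the first and concatenate with `ℓ₂^{±1}`;
the proof is module XX's `loopFactor_mul_loopFactor_mem_span` with the formula as a hypothesis). [folklore] -/
theorem loopFactor_mul_loopFactor_mem_span_of_prod
    (hprod : ∀ b₁ b₂ : Bool, ∃ c₁ c₂ : ℝ, ∃ b : Bool, ∀ g h : G,
      tracePart ρ b₁ g * tracePart ρ b₂ h = c₁ * tracePart ρ b (g * h) + c₂ * tracePart ρ b (g * h⁻¹))
    (p₁ p₂ : (Σ x : (Fin d → ℤ), (zdGraph d).Walk x x) × Bool) :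
    loopFactor ρ p₁ * loopFactor ρ p₂ ∈ Submodule.span ℝ (Set.range (loopFactor (d := d) ρ)) := by
  obtain ⟨⟨x₁, ℓ₁⟩, b₁⟩ := p₁
  obtain ⟨⟨x₂, ℓ₂⟩, b₂⟩ := p₂
  obtain ⟨c₁, c₂, b, hb⟩ := hprod b₁ b₂
  let γ : (zdGraph d).Walk x₁ x₂ := (zdGraph_reachable x₁ x₂).some
  let Lp : (zdGraph d).Walk x₁ x₁ := ℓ₁.append (γ.append (ℓ₂.append γ.reverse))
  let Lm : (zdGraph d).Walk x₁ x₁ := ℓ₁.append (γ.append (ℓ₂.reverse.append γ.reverse))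
  have key : loopFactor ρ (⟨x₁, ℓ₁⟩, b₁) * loopFactor ρ (⟨x₂, ℓ₂⟩, b₂) =
      c₁ • loopFactor ρ (⟨x₁, Lp⟩, b) + c₂ • loopFactor ρ (⟨x₁, Lm⟩, b) := by
    funext U
    have h2 : tracePart ρ b₂ (walkHolonomy U ℓ₂) =
        tracePart ρ b₂ (walkHolonomy U γ * walkHolonomy U ℓ₂ * (walkHolonomy U γ)⁻¹) := (tracePart_conj ρ b₂ _ _).symm
    simp only [Pi.mul_apply, Pi.add_apply, Pi.smul_apply, smul_eq_mul, loopFactor_eq_tracePart, Lp, Lm,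
      walkHolonomy_append, walkHolonomy_reverse]
    rw [h2, hb _ _]
    congr 2
    · simp only [mul_assoc]
    · simp only [mul_inv_rev, inv_inv, mul_assoc]
  rw [key]
  exact Submodule.add_mem _ (Submodule.smul_mem _ _ (Submodule.subset_span ⟨_, rfl⟩))
    (Submodule.smul_mem _ _ (Submodule.subset_span ⟨_, rfl⟩))

/-- The generator of the trivial loop is the constant `N = Re tr ρ(1)`. [folklore] -/
theorem loopFactor_nil_true_eq_const (x : Fin d → ℤ) :
    loopFactor ρ (⟨x, (SimpleGraph.Walk.nil : (zdGraph d).Walk x x)⟩, true) = fun _ => (N : ℝ) := by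
  funext U
  rw [loopFactor_eq_tracePart]
  simp [tracePart]

/-- **Under a product-to-sum formula (and `N ≠ 0`), the span of the Wilson-loop PRODUCTS is the span of the SINGLE
Wilson loops** (induction on the number of factors; the empty product is `N⁻¹ · Re tr ρ(U_{trivial loop})`).
[folklore] -/
theorem span_wilsonLoopProducts_le_span_loopFactor_of_prod (hN : N ≠ 0)
    (hprod : ∀ b₁ b₂ : Bool, ∃ c₁ c₂ : ℝ, ∃ b : Bool, ∀ g h : G,
      tracePart ρ b₁ g * tracePart ρ b₂ h = c₁ * tracePart ρ b (g * h) + c₂ * tracePart ρ b (g * h⁻¹)) :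
    Submodule.span ℝ (wilsonLoopProducts ρ d) ≤ Submodule.span ℝ (Set.range (loopFactor (d := d) ρ)) := by
  refine Submodule.span_le.2 ?_
  rintro _ ⟨l, rfl⟩
  induction l with
  | nil =>
    have h1 : loopProduct (d := d) ρ [] =
        (N : ℝ)⁻¹ • loopFactor ρ (⟨(0 : Fin d → ℤ), (SimpleGraph.Walk.nil : (zdGraph d).Walk 0 0)⟩, true) := by
      rw [loopProduct_nil, loopFactor_nil_true_eq_const]
      funext U
      simp [hN]
    rw [h1]
    exact Submodule.smul_mem _ _ (Submodule.subset_span ⟨_, rfl⟩)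
  | cons p l ih =>
    rw [loopProduct_cons]
    change loopFactor ρ p * loopProduct ρ l ∈ _
    refine Submodule.span_induction (p := fun q _ => loopFactor ρ p * q ∈ Submodule.span ℝ (Set.range (loopFactor ρ)))
      ?_ ?_ ?_ ?_ ih
    · rintro _ ⟨p', rfl⟩
      exact loopFactor_mul_loopFactor_mem_span_of_prod ρ hprod p p'
    · simp
    · intro q₁ q₂ _ _ h₁ h₂
      rw [mul_add]
      exact Submodule.add_mem _ h₁ h₂
    · intro c q _ hq
      rw [mul_smul_comm]
      exact Submodule.smul_mem _ c hq

variable [TopologicalSpace G]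

/-- Hence, under a product-to-sum formula, density of the Wilson-loop PRODUCTS in the gauge-invariant cylinders passes
to the SINGLE Wilson loops. [folklore] -/
theorem spansGaugeInvariantCylinders_loopFactor_of_prod (hN : N ≠ 0)
    (hprod : ∀ b₁ b₂ : Bool, ∃ c₁ c₂ : ℝ, ∃ b : Bool, ∀ g h : G,
      tracePart ρ b₁ g * tracePart ρ b₂ h = c₁ * tracePart ρ b (g * h) + c₂ * tracePart ρ b (g * h⁻¹))
    (hdense : SpansGaugeInvariantCylinders d (wilsonLoopProducts ρ d)) :
    SpansGaugeInvariantCylinders d (Set.range (loopFactor (d := d) ρ)) := by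
  intro F S hFS hFc hFb hFg ε hε
  obtain ⟨W, hW, hclose⟩ := hdense F S hFS hFc hFb hFg ε hε
  exact ⟨W, span_wilsonLoopProducts_le_span_loopFactor_of_prod ρ hN hprod hW, hclose⟩

variable [IsTopologicalGroup G] [CompactSpace G] [MeasurableSpace G] [BorelSpace G] [SecondCountableTopology G]
  [T2Space G]

/-- **`(3a) ⟺ (W-single)` whenever the SINGLE Wilson loops span a dense subspace of the gauge-invariant cylinders**
(module XIX's dense-class reduction `hasUniqueInfiniteVolumeLimit_iff_tendsto_of_spans` applied to the class of single
generators; module XX's `hasUniqueInfiniteVolumeLimit_iff_hasWilsonLoopLimits` is the case `N = 1`).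
[cite: Levy2004, Thm 3.1 p.5] -/
theorem hasUniqueInfiniteVolumeLimit_iff_hasWilsonLoopLimits_of_spans (hρ : Continuous ρ) (β : ℝ)
    (hdense : SpansGaugeInvariantCylinders d (Set.range (loopFactor (d := d) ρ))) :
    HasUniqueInfiniteVolumeLimit (d := d) ρ β ↔ HasWilsonLoopLimits ρ d β := by
  have h𝒲 : ∀ W ∈ Set.range (loopFactor (d := d) ρ), IsLocalObservable W ∧ Measurable W ∧ ∃ C, ∀ U, |W U| ≤ C := by
    rintro W ⟨p, rfl⟩
    exact ⟨isLocalObservable_loopFactor ρ p, (continuous_loopFactor ρ hρ p).measurable, exists_abs_loopFactor_le ρ hρ p⟩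
  rw [hasUniqueInfiniteVolumeLimit_iff_tendsto_of_spans ρ hρ β h𝒲 hdense]
  simp only [HasWilsonLoopLimits, Set.forall_mem_range]

end ProductToSum

/-! ## PART B — `SU(2)`: THE FRICKE TRACE IDENTITY AND ITS CONSEQUENCE `(W-single)`-DENSITY -/

section Fricke

/-- **The Fricke trace identity for `2 × 2` matrices**: `tr(AB) + tr(A·adj B) = tr A · tr B` over any commutative
ring (for `det B = 1`, `adj B = B⁻¹`: `tr(AB) + tr(AB⁻¹) = tr A tr B`). [folklore] -/
theorem trace_mul_add_trace_mul_adjugate {R : Type*} [CommRing R] (A B : Matrix (Fin 2) (Fin 2) R) :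
    (A * B).trace + (A * B.adjugate).trace = A.trace * B.trace := by
  rw [Matrix.adjugate_fin_two]
  simp [Matrix.trace_fin_two, Matrix.mul_apply, Fin.sum_univ_two]
  ring

end Fricke

section SU2Matrix

/-- For `U ∈ SU(2)` the conjugate transpose is the adjugate (both are `U⁻¹`). [folklore] -/
theorem su2_star_val_eq_adjugate (U : Matrix.specialUnitaryGroup (Fin 2) ℂ) :
    star (U : Matrix (Fin 2) (Fin 2) ℂ) = (U : Matrix (Fin 2) (Fin 2) ℂ).adjugate := by
  have hU := Matrix.mem_specialUnitaryGroup_iff.1 U.2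
  have h1 : star (U : Matrix (Fin 2) (Fin 2) ℂ) * U = 1 := Matrix.mem_unitaryGroup_iff'.1 hU.1
  have h2 : (U : Matrix (Fin 2) (Fin 2) ℂ) * (U : Matrix (Fin 2) (Fin 2) ℂ).adjugate = 1 := by
    rw [Matrix.mul_adjugate, hU.2, one_smul]
  calc star (U : Matrix (Fin 2) (Fin 2) ℂ)
      = star (U : Matrix (Fin 2) (Fin 2) ℂ) * ((U : Matrix (Fin 2) (Fin 2) ℂ) * (U : Matrix _ _ ℂ).adjugate) := by
        rw [h2, mul_one]
    _ = (U : Matrix (Fin 2) (Fin 2) ℂ).adjugate := by rw [← mul_assoc, h1, one_mul]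

/-- The second row of `U ∈ SU(2)` is determined by the first: `U₁₀ = -conj U₀₁`. [folklore] -/
theorem su2_val_10 (U : Matrix.specialUnitaryGroup (Fin 2) ℂ) :
    (U : Matrix (Fin 2) (Fin 2) ℂ) 1 0 = -(starRingEnd ℂ) ((U : Matrix (Fin 2) (Fin 2) ℂ) 0 1) := by
  have h := congrFun (congrFun (su2_star_val_eq_adjugate U) 1) 0
  rw [Matrix.adjugate_fin_two, Matrix.star_apply] at h
  simp only [Matrix.of_apply, Matrix.cons_val', Matrix.cons_val_zero, Matrix.cons_val_one,
    Matrix.cons_val_fin_one] at h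
  have h' : (U : Matrix (Fin 2) (Fin 2) ℂ) 1 0 = -star ((U : Matrix (Fin 2) (Fin 2) ℂ) 0 1) := by
    rw [h, neg_neg]
  rw [h', Complex.star_def]

/-- The second row of `U ∈ SU(2)` is determined by the first: `U₁₁ = conj U₀₀`. [folklore] -/
theorem su2_val_11 (U : Matrix.specialUnitaryGroup (Fin 2) ℂ) :
    (U : Matrix (Fin 2) (Fin 2) ℂ) 1 1 = (starRingEnd ℂ) ((U : Matrix (Fin 2) (Fin 2) ℂ) 0 0) := by
  have h := congrFun (congrFun (su2_star_val_eq_adjugate U) 0) 0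
  rw [Matrix.adjugate_fin_two, Matrix.star_apply] at h
  simp only [Matrix.of_apply, Matrix.cons_val', Matrix.cons_val_zero, Matrix.cons_val_fin_one] at h
  rw [← h, Complex.star_def]

/-- `|U₀₀|² + |U₀₁|² = 1` for `U ∈ SU(2)` (`det U = 1`). [folklore] -/
theorem su2_normSq_val00_add_normSq_val01 (U : Matrix.specialUnitaryGroup (Fin 2) ℂ) :
    Complex.normSq ((U : Matrix (Fin 2) (Fin 2) ℂ) 0 0) + Complex.normSq ((U : Matrix (Fin 2) (Fin 2) ℂ) 0 1) = 1 := by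
  have hdet : (U : Matrix (Fin 2) (Fin 2) ℂ).det = 1 := (Matrix.mem_specialUnitaryGroup_iff.1 U.2).2
  rw [Matrix.det_fin_two, su2_val_10, su2_val_11] at hdet
  have h : ((Complex.normSq ((U : Matrix (Fin 2) (Fin 2) ℂ) 0 0) +
      Complex.normSq ((U : Matrix (Fin 2) (Fin 2) ℂ) 0 1) : ℝ) : ℂ) = 1 := by
    rw [← hdet]
    push_cast
    rw [← Complex.mul_conj, ← Complex.mul_conj]
    ring
  exact_mod_cast h

/-- An element of `SU(2)` is determined by its first row. [folklore] -/
theorem su2_ext {U U' : Matrix.specialUnitaryGroup (Fin 2) ℂ}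
    (h0 : (U : Matrix (Fin 2) (Fin 2) ℂ) 0 0 = (U' : Matrix (Fin 2) (Fin 2) ℂ) 0 0)
    (h1 : (U : Matrix (Fin 2) (Fin 2) ℂ) 0 1 = (U' : Matrix (Fin 2) (Fin 2) ℂ) 0 1) : U = U' := by
  apply Subtype.ext
  ext i j
  fin_cases i <;> fin_cases j
  · exact h0
  · exact h1
  · show (U : Matrix (Fin 2) (Fin 2) ℂ) 1 0 = (U' : Matrix (Fin 2) (Fin 2) ℂ) 1 0
    rw [su2_val_10, su2_val_10, h1]
  · show (U : Matrix (Fin 2) (Fin 2) ℂ) 1 1 = (U' : Matrix (Fin 2) (Fin 2) ℂ) 1 1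
    rw [su2_val_11, su2_val_11, h0]

/-- `tr U = 2 Re U₀₀` for `U ∈ SU(2)`; in particular the character of `SU(2)` is REAL. [folklore] -/
theorem su2_trace (U : Matrix.specialUnitaryGroup (Fin 2) ℂ) :
    (U : Matrix (Fin 2) (Fin 2) ℂ).trace = ((2 * ((U : Matrix (Fin 2) (Fin 2) ℂ) 0 0).re : ℝ) : ℂ) := by
  rw [Matrix.trace_fin_two, su2_val_11, Complex.add_conj]

/-- `Re tr`, as the `true` trace part of the defining representation, is `Re` of the trace … [folklore] -/
theorem tracePart_true_fundamentalRep_two (U : Matrix.specialUnitaryGroup (Fin 2) ℂ) :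
    tracePart (fundamentalRep (Fin 2)) true U = ((U : Matrix (Fin 2) (Fin 2) ℂ).trace).re := rfl

/-- … namely `2 Re U₀₀`, … [folklore] -/
theorem tracePart_true_su2 (U : Matrix.specialUnitaryGroup (Fin 2) ℂ) :
    tracePart (fundamentalRep (Fin 2)) true U = 2 * ((U : Matrix (Fin 2) (Fin 2) ℂ) 0 0).re := by
  rw [tracePart_true_fundamentalRep_two, su2_trace, Complex.ofReal_re]

/-- … and the `false` (imaginary) trace part VANISHES identically on `SU(2)`. [folklore] -/
theorem tracePart_false_su2 (U : Matrix.specialUnitaryGroup (Fin 2) ℂ) :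
    tracePart (fundamentalRep (Fin 2)) false U = 0 := by
  show ((fundamentalRep (Fin 2) U).trace).im = 0
  rw [fundamentalRep_apply, su2_trace, Complex.ofReal_im]

/-- **Fricke in `SU(2)`**: `tr(gh) + tr(gh⁻¹) = tr g · tr h`. [folklore] -/
theorem su2_trace_mul_add_trace_mul_inv (g h : Matrix.specialUnitaryGroup (Fin 2) ℂ) :
    ((g * h : Matrix.specialUnitaryGroup (Fin 2) ℂ) : Matrix (Fin 2) (Fin 2) ℂ).trace +
        ((g * h⁻¹ : Matrix.specialUnitaryGroup (Fin 2) ℂ) : Matrix (Fin 2) (Fin 2) ℂ).trace =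
      (g : Matrix (Fin 2) (Fin 2) ℂ).trace * (h : Matrix (Fin 2) (Fin 2) ℂ).trace := by
  rw [Submonoid.coe_mul, Submonoid.coe_mul, coe_inv_eq_star, su2_star_val_eq_adjugate]
  exact trace_mul_add_trace_mul_adjugate _ _

/-- **The product-to-sum formula for the character of `SU(2)`**: `Re tr g · Re tr h = Re tr(gh) + Re tr(gh⁻¹)`
(the traces are real), and every product with an imaginary part is `0 = 0·… + 0·…`. [folklore] -/
theorem tracePart_mul_tracePart_su2 (b₁ b₂ : Bool) : ∃ c₁ c₂ : ℝ, ∃ b : Bool,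
    ∀ g h : Matrix.specialUnitaryGroup (Fin 2) ℂ,
      tracePart (fundamentalRep (Fin 2)) b₁ g * tracePart (fundamentalRep (Fin 2)) b₂ h =
        c₁ * tracePart (fundamentalRep (Fin 2)) b (g * h) + c₂ * tracePart (fundamentalRep (Fin 2)) b (g * h⁻¹) := by
  cases b₁ <;> cases b₂
  · exact ⟨0, 0, true, fun g h => by simp [tracePart_false_su2]⟩
  · exact ⟨0, 0, true, fun g h => by simp [tracePart_false_su2]⟩
  · exact ⟨0, 0, true, fun g h => by simp [tracePart_false_su2]⟩
  · refine ⟨1, 1, true, fun g h => ?_⟩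
    have h1 := congrArg Complex.re (su2_trace_mul_add_trace_mul_inv g h)
    rw [Complex.add_re, Complex.mul_re] at h1
    have hig : ((g : Matrix (Fin 2) (Fin 2) ℂ).trace).im = 0 := by rw [su2_trace, Complex.ofReal_im]
    have hih : ((h : Matrix (Fin 2) (Fin 2) ℂ).trace).im = 0 := by rw [su2_trace, Complex.ofReal_im]
    rw [hig, hih, mul_zero, sub_zero] at h1
    simp only [tracePart_true_fundamentalRep_two, one_mul]
    linarith

variable {d : ℕ}

/-- **For `SU(2)` the span of the Wilson-loop PRODUCTS is the span of the SINGLE Wilson loops** (Fricke).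
[folklore] -/
theorem span_wilsonLoopProducts_le_span_loopFactor_su2 :
    Submodule.span ℝ (wilsonLoopProducts (fundamentalRep (Fin 2)) d) ≤
      Submodule.span ℝ (Set.range (loopFactor (d := d) (fundamentalRep (Fin 2)))) :=
  span_wilsonLoopProducts_le_span_loopFactor_of_prod (fundamentalRep (Fin 2)) two_ne_zero tracePart_mul_tracePart_su2

end SU2Matrix

/-! ## PART C — THE ORBIT-SEPARATION SCHEMA, AND STONE–WEIERSTRASS THROUGH THE WORD-TRACE MAP -/

section WordsContinuity

variable {G : Type*} [Group G] [TopologicalSpace G] [IsTopologicalGroup G]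

/-- Each letter `V ↦ V_i^{±1}` is continuous in the variables. [folklore] -/
theorem continuous_letterVal {ι : Type*} (a : ι × Bool) : Continuous fun V : ι → G => letterVal V a := by
  rcases a with ⟨i, _ | _⟩
  · show Continuous fun V : ι → G => (V i)⁻¹
    exact (continuous_apply i).inv
  · exact continuous_apply i

/-- Each word `V ↦ w(V)` is continuous in the variables. [folklore] -/
theorem continuous_wordVal {ι : Type*} (w : List (ι × Bool)) : Continuous fun V : ι → G => wordVal w V := by
  induction w with
  | nil => simp only [wordVal_nil]; exact continuous_const
  | cons a w ih => simp only [wordVal_cons]; exact (continuous_letterVal a).mul ih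

end WordsContinuity

namespace Balaban1983to89.Missing

variable {G : Type*} [Group G] {N : ℕ} (ρ : G →* Matrix (Fin N) (Fin N) ℂ)

/-- **`TraceWordsSeparateOrbits ρ` — WORD TRACES SEPARATE SIMULTANEOUS-CONJUGATION ORBITS**: for every finite index
type `ι` and all `V, W : ι → G`, if `Re tr ρ(w(V)) = Re tr ρ(w(W))` and `Im tr ρ(w(V)) = Im tr ρ(w(W))` for EVERY word
`w` in the letters `i^{±1}`, then `W = g V g⁻¹` for a single `g ∈ G` (the tuples lie in the same diagonal conjugacy
class).  This is the SHAPE of Lévy 2004 Prop. 3.4 (there: `G` a finite product of `U(n), SU(n), O(n), SO(n), Sp(n)`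
and ALL irreducible characters; here ONE representation `ρ`), i.e. of the statement that the invariants `tr w`
separate the closed orbits (first fundamental theorem of invariant theory for `n`-tuples of matrices).  For the
defining representation of `U(n)` / `SU(n)` it is, word for word, the form of Sengupta 1994 Thm 2 that its proof
uses (Proc. AMS 121, p.900: «Theorem 2. Let G be a product of groups from the following list : abelian groups, the
unitary groups U(n), special unitary groups SU(n), orthogonal groups O(n), and the odd special orthogonal groups
SO(2n + 1). Suppose that {g_a}_{a ∈ I} and {g'_a}_{a ∈ I} are families of elements of G such that for every
a_1, …, a_k ∈ I the product g_{a_1} ⋯ g_{a_k} is conjugate in G to g'_{a_1} ⋯ g'_{a_k}. Then there is an element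
y ∈ G such that g'_a = y g_a y⁻¹ for every a ∈ I.», and in the proof: «The hypothesis implies that the trace of the
product g_{i_1} ⋯ g_{i_k} equals the trace of g'_{i_1} ⋯ g'_{i_k} for every positive integer k and every
i_1, …, i_k ∈ {1, …, m}. It is only this apparently weaker hypothesis that will be used.»).  PROVED below, in the
kernel, for `G = SU(2)` with its defining representation (`traceWordsSeparateOrbits_su2`; positive words of length
`≤ 3` suffice) and for every `ρ` whose character separates points (`traceWordsSeparateOrbits_of_trace_injective`);
REFUTED for the real representation `so2Rep` of `U(1)` (`not_traceWordsSeparateOrbits_so2Rep`); it IMPLIES the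
density schema `TraceWordsDense ρ` for compact `G` and continuous `ρ` (`traceWordsDense_of_traceWordsSeparateOrbits`,
real Stone–Weierstrass).  NOT kernel-proved for `SU(n)`, `n ≥ 3` (in print: Sengupta 1994 Thm 2).  A `Prop`-valued
schema used as a HYPOTHESIS; nothing is asserted. [cite: Sengupta1994, Thm 2 p.900] -/
def TraceWordsSeparateOrbits : Prop :=
  ∀ (ι : Type) [Fintype ι] (V W : ι → G),
    (∀ (w : List (ι × Bool)) (b : Bool), tracePart ρ b (wordVal w V) = tracePart ρ b (wordVal w W)) →
      ∃ g : G, ∀ i, W i = g * V i * g⁻¹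

end Balaban1983to89.Missing

open Balaban1983to89.Missing (TraceWordsSeparateOrbits)

section OrbitStoneWeierstrass

variable {N : ℕ} {G : Type*} [Group G] (ρ : G →* Matrix (Fin N) (Fin N) ℂ)

/-- THE WORD-TRACE MAP `Φ : (ι → G) → ℝ^{words × {Re, Im}}`, `Φ(V)_{(w,b)} = Re/Im tr ρ(w(V))`. [folklore] -/
def wordTraceMap (ι : Type*) (V : ι → G) : List (ι × Bool) × Bool → ℝ := fun j => tracePart ρ j.2 (wordVal j.1 V)

/-- `Φ V = Φ W` iff all word traces of `V` and `W` agree. [folklore] -/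
theorem wordTraceMap_eq_iff {ι : Type*} (V W : ι → G) :
    wordTraceMap ρ ι V = wordTraceMap ρ ι W ↔
      ∀ (w : List (ι × Bool)) (b : Bool), tracePart ρ b (wordVal w V) = tracePart ρ b (wordVal w W) :=
  ⟨fun h w b => congr_fun h (w, b), fun h => funext fun j => h j.1 j.2⟩

/-- `Φ` is constant on simultaneous-conjugation orbits (traces of words are class functions). [folklore] -/
theorem wordTraceMap_conj {ι : Type*} (V : ι → G) (g : G) :
    wordTraceMap ρ ι (fun i => g * V i * g⁻¹) = wordTraceMap ρ ι V := by
  funext j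
  simp only [wordTraceMap, wordVal_conj, tracePart_conj]

/-- The coordinate functions of the range `Y = Φ(G^ι) ⊆ ℝ^J`, as continuous maps `Y → ℝ`. [folklore] -/
def rangeCoord (ι : Type*) (j : List (ι × Bool) × Bool) : C(↥(Set.range (wordTraceMap ρ ι)), ℝ) :=
  ⟨fun y => (y : List (ι × Bool) × Bool → ℝ) j, (continuous_apply j).comp continuous_subtype_val⟩

/-- The coordinate functions separate the points of `Y` (tautologically), hence so does the unital real subalgebra
they generate. [folklore] -/
theorem rangeCoord_separatesPoints (ι : Type*) :
    (Algebra.adjoin ℝ (Set.range (rangeCoord ρ ι))).SeparatesPoints := by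
  intro y y' hne
  have hne' : (y : List (ι × Bool) × Bool → ℝ) ≠ y' := fun h => hne (Subtype.ext h)
  obtain ⟨j, hj⟩ := Function.ne_iff.1 hne'
  exact ⟨rangeCoord ρ ι j, ⟨rangeCoord ρ ι j, Algebra.subset_adjoin ⟨j, rfl⟩, rfl⟩, hj⟩

/-- PULL-BACK: every element of the coordinate algebra of `Y`, precomposed with `Φ`, is (as a function on `ι → G`)
in the real span of the trace-word products (a coordinate pulls back to a single trace word; constants, sums and
products as in module XX `coe_mem_span_traceWordProducts`). [folklore] -/
theorem comp_wordTraceMap_mem_span {ι : Type*} {q : C(↥(Set.range (wordTraceMap ρ ι)), ℝ)}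
    (hq : q ∈ Algebra.adjoin ℝ (Set.range (rangeCoord ρ ι))) :
    (fun V : ι → G => q ⟨wordTraceMap ρ ι V, Set.mem_range_self V⟩) ∈ Submodule.span ℝ (traceWordProducts ρ ι) := by
  induction hq using Algebra.adjoin_induction with
  | mem x hx =>
    obtain ⟨j, rfl⟩ := hx
    refine Submodule.subset_span ⟨[j], ?_⟩
    funext V
    simp [traceWordProduct, rangeCoord, wordTraceMap]
  | algebraMap r =>
    have h : (fun V : ι → G => (algebraMap ℝ C(↥(Set.range (wordTraceMap ρ ι)), ℝ) r)
        ⟨wordTraceMap ρ ι V, Set.mem_range_self V⟩) = r • traceWordProduct (ι := ι) ρ [] := by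
      funext V
      simp [Algebra.algebraMap_eq_smul_one]
    rw [h]
    exact Submodule.smul_mem _ r (Submodule.subset_span ⟨[], rfl⟩)
  | add x y _ _ hx hy =>
    have h : (fun V : ι → G => (x + y) ⟨wordTraceMap ρ ι V, Set.mem_range_self V⟩) =
        (fun V => x ⟨wordTraceMap ρ ι V, Set.mem_range_self V⟩) +
          fun V => y ⟨wordTraceMap ρ ι V, Set.mem_range_self V⟩ := by
      funext V; simp
    rw [h]
    exact Submodule.add_mem _ hx hy
  | mul x y _ _ hx hy =>
    have h : (fun V : ι → G => (x * y) ⟨wordTraceMap ρ ι V, Set.mem_range_self V⟩) =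
        (fun V => x ⟨wordTraceMap ρ ι V, Set.mem_range_self V⟩) *
          fun V => y ⟨wordTraceMap ρ ι V, Set.mem_range_self V⟩ := by
      funext V; simp
    rw [h]
    exact mul_mem_span_traceWordProducts ρ hx hy

/-- The new schema SUBSUMES module XX's hypothesis: if the character of `ρ` separates points, then already the
one-letter words separate orbits (indeed `V = W`, `g = 1`). [folklore] -/
theorem traceWordsSeparateOrbits_of_trace_injective (hinj : Function.Injective fun g => (ρ g).trace) :
    TraceWordsSeparateOrbits ρ := by
  intro ι _ V W h
  refine ⟨1, fun i => ?_⟩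
  rw [one_mul, inv_one, mul_one]
  have hre := h [(i, true)] true
  have him := h [(i, true)] false
  simp only [tracePart, wordVal_cons, wordVal_nil, letterVal, mul_one, ite_true] at hre him
  exact (hinj (Complex.ext hre him)).symm

variable [TopologicalSpace G] [IsTopologicalGroup G]

/-- `Φ` is continuous for continuous `ρ`. [folklore] -/
theorem continuous_wordTraceMap (hρ : Continuous ρ) (ι : Type*) : Continuous (wordTraceMap ρ ι) :=
  continuous_pi fun j => (continuous_tracePart ρ hρ j.2).comp (continuous_wordVal j.1)

variable [CompactSpace G]

/-- **ORBIT SEPARATION IMPLIES DENSITY (real Stone–Weierstrass through the word-trace map).**  For a compact group `G`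
and a continuous representation `ρ` whose word traces separate the simultaneous-conjugation orbits, the trace words
are dense in several variables: a continuous conjugation-invariant `f : (ι → G) → ℝ` is constant on the fibres of the
word-trace map `Φ` (fibres = orbits, by separation), so `f = f̄ ∘ Φ` with `f̄` continuous on the compact Hausdorff range
`Y = Φ(G^ι) ⊆ ℝ^J` (`Φ : G^ι → Y` is a closed continuous surjection, hence a quotient map); the coordinate functions
separate the points of `Y`, so `f̄` is uniformly approximable by real polynomials in the coordinates
(`ContinuousMap.exists_mem_subalgebra_near_continuous_of_separatesPoints`), whose pull-backs along `Φ` are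
polynomials in the trace words.  This is the SHAPE of Lévy 2004, proof of Prop. 3.6 (p.5: «Hence, Wilson loops
separate the points on the configuration space. Since this space is compact, the result follows by the
Stone-Weierstrass theorem.»), with his Prop. 3.4 (orbit separation) as the hypothesis; Prop. 3.5 is the fill-gap
statement (paths to a base vertex), formalised on `ℤ^d` in module XX PART A. [cite: Levy2004, Props 3.4–3.6 p.5] -/
theorem traceWordsDense_of_traceWordsSeparateOrbits (hρ : Continuous ρ) (hsep : TraceWordsSeparateOrbits ρ) :
    TraceWordsDense ρ := by
  intro ι _ f hf hfinv ε hε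
  classical
  let Y : Set (List (ι × Bool) × Bool → ℝ) := Set.range (wordTraceMap ρ ι)
  have hΦc : Continuous (wordTraceMap ρ ι) := continuous_wordTraceMap ρ hρ ι
  haveI : CompactSpace ↥Y := isCompact_iff_compactSpace.1 (isCompact_range hΦc)
  let π : (ι → G) → ↥Y := fun V => ⟨wordTraceMap ρ ι V, Set.mem_range_self V⟩
  have hπc : Continuous π := hΦc.subtype_mk _
  have hπs : Function.Surjective π := by
    rintro ⟨y, V, rfl⟩
    exact ⟨V, rfl⟩
  -- `f` is constant on the fibres of `Φ` (= the orbits)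
  have hfib : ∀ V W : ι → G, wordTraceMap ρ ι V = wordTraceMap ρ ι W → f V = f W := by
    intro V W h
    obtain ⟨g, hg⟩ := hsep ι V W ((wordTraceMap_eq_iff ρ V W).1 h)
    rw [show W = fun i => g * V i * g⁻¹ from funext hg, hfinv]
  -- the factorisation `f = fbar ∘ π`
  let fbar : ↥Y → ℝ := fun y => f (Classical.choose y.2)
  have hfbar : ∀ V, fbar (π V) = f V := fun V =>
    hfib _ _ (Classical.choose_spec (π V).2)
  have hfbar_c : Continuous fbar := by
    rw [((hπc.isClosedMap).isQuotientMap hπc hπs).continuous_iff, show fbar ∘ π = f from funext hfbar]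
    exact hf
  obtain ⟨q, hq⟩ := ContinuousMap.exists_mem_subalgebra_near_continuous_of_separatesPoints
    (Algebra.adjoin ℝ (Set.range (rangeCoord ρ ι))) (rangeCoord_separatesPoints ρ ι) fbar hfbar_c ε hε
  refine ⟨fun V => (q : C(↥Y, ℝ)) (π V), comp_wordTraceMap_mem_span ρ q.2, fun V => ?_⟩
  have h := hq (π V)
  rw [hfbar, Real.norm_eq_abs, abs_sub_comm] at h
  exact h.le

/-- Hence Lévy's density on `ℤ^d` for such `ρ`, in every dimension (module XX's reduction theorem).
[cite: Levy2004, Thm 3.1 and Props 3.4–3.6 pp.5–6] -/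
theorem spansGaugeInvariantCylinders_of_traceWordsSeparateOrbits {d : ℕ} (hρ : Continuous ρ)
    (hsep : TraceWordsSeparateOrbits ρ) : SpansGaugeInvariantCylinders d (wilsonLoopProducts ρ d) :=
  spansGaugeInvariantCylinders_of_traceWordsDense ρ (traceWordsDense_of_traceWordsSeparateOrbits ρ hρ hsep)

variable [MeasurableSpace G] [BorelSpace G] [SecondCountableTopology G] [T2Space G]

/-- **`(3a) ⟺ (W-corr)` WITHOUT A DENSITY HYPOTHESIS for every continuous representation of a compact group whose
word traces separate orbits** (every `d`, every real `β`). [cite: Levy2004, Thm 3.1 p.5] -/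
theorem hasUniqueInfiniteVolumeLimit_iff_hasWilsonLoopCorrelationLimits_of_traceWordsSeparateOrbits {d : ℕ}
    (hρ : Continuous ρ) (hsep : TraceWordsSeparateOrbits ρ) (β : ℝ) :
    HasUniqueInfiniteVolumeLimit (d := d) ρ β ↔ HasWilsonLoopCorrelationLimits ρ d β :=
  hasUniqueInfiniteVolumeLimit_iff_hasWilsonLoopCorrelationLimits ρ hρ β
    (spansGaugeInvariantCylinders_of_traceWordsSeparateOrbits ρ hρ hsep)

end OrbitStoneWeierstrass


/-! ## PART D — `SU(2)`: WORD TRACES OF LENGTH `≤ 3` SEPARATE THE SIMULTANEOUS-CONJUGATION ORBITS -/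

section SU2Orbits

/-! ### D.1  First-row algebra in `SU(2)` (products, inverses, conjugation by the diagonal torus) -/

/-- `(UU')₀₀ = U₀₀U'₀₀ − U₀₁ conj U'₀₁`. [folklore] -/
theorem su2_mul_val_00 (U U' : Matrix.specialUnitaryGroup (Fin 2) ℂ) :
    ((U * U' : Matrix.specialUnitaryGroup (Fin 2) ℂ) : Matrix (Fin 2) (Fin 2) ℂ) 0 0 =
      (U : Matrix (Fin 2) (Fin 2) ℂ) 0 0 * (U' : Matrix (Fin 2) (Fin 2) ℂ) 0 0 -
        (U : Matrix (Fin 2) (Fin 2) ℂ) 0 1 * (starRingEnd ℂ) ((U' : Matrix (Fin 2) (Fin 2) ℂ) 0 1) := by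
  rw [Submonoid.coe_mul, Matrix.mul_apply, Fin.sum_univ_two, su2_val_10]
  ring

/-- `(UU')₀₁ = U₀₀U'₀₁ + U₀₁ conj U'₀₀`. [folklore] -/
theorem su2_mul_val_01 (U U' : Matrix.specialUnitaryGroup (Fin 2) ℂ) :
    ((U * U' : Matrix.specialUnitaryGroup (Fin 2) ℂ) : Matrix (Fin 2) (Fin 2) ℂ) 0 1 =
      (U : Matrix (Fin 2) (Fin 2) ℂ) 0 0 * (U' : Matrix (Fin 2) (Fin 2) ℂ) 0 1 +
        (U : Matrix (Fin 2) (Fin 2) ℂ) 0 1 * (starRingEnd ℂ) ((U' : Matrix (Fin 2) (Fin 2) ℂ) 0 0) := by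
  rw [Submonoid.coe_mul, Matrix.mul_apply, Fin.sum_univ_two, su2_val_11]

/-- `(U⁻¹)₀₀ = conj U₀₀`. [folklore] -/
theorem su2_inv_val_00 (U : Matrix.specialUnitaryGroup (Fin 2) ℂ) :
    ((U⁻¹ : Matrix.specialUnitaryGroup (Fin 2) ℂ) : Matrix (Fin 2) (Fin 2) ℂ) 0 0 =
      (starRingEnd ℂ) ((U : Matrix (Fin 2) (Fin 2) ℂ) 0 0) := by
  rw [coe_inv_eq_star, Matrix.star_apply, Complex.star_def]

/-- `(U⁻¹)₀₁ = −U₀₁`. [folklore] -/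
theorem su2_inv_val_01 (U : Matrix.specialUnitaryGroup (Fin 2) ℂ) :
    ((U⁻¹ : Matrix.specialUnitaryGroup (Fin 2) ℂ) : Matrix (Fin 2) (Fin 2) ℂ) 0 1 =
      -((U : Matrix (Fin 2) (Fin 2) ℂ) 0 1) := by
  rw [coe_inv_eq_star, Matrix.star_apply, su2_val_10, star_neg, Complex.star_def, Complex.conj_conj]

/-- A DIAGONAL element `T` (`T₀₁ = 0`) has `T₀₀ conj T₀₀ = 1`. [folklore] -/
theorem su2_diag_mul_conj {T : Matrix.specialUnitaryGroup (Fin 2) ℂ} (hT : (T : Matrix (Fin 2) (Fin 2) ℂ) 0 1 = 0) :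
    (T : Matrix (Fin 2) (Fin 2) ℂ) 0 0 * (starRingEnd ℂ) ((T : Matrix (Fin 2) (Fin 2) ℂ) 0 0) = 1 := by
  have h := su2_normSq_val00_add_normSq_val01 T
  rw [hT, map_zero, add_zero] at h
  rw [Complex.mul_conj, h, Complex.ofReal_one]

/-- Left multiplication by a diagonal `T` multiplies `U₀₀` by `T₀₀`. [folklore] -/
theorem su2_diag_mul_val_00 {T : Matrix.specialUnitaryGroup (Fin 2) ℂ} (hT : (T : Matrix (Fin 2) (Fin 2) ℂ) 0 1 = 0)
    (U : Matrix.specialUnitaryGroup (Fin 2) ℂ) :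
    ((T * U : Matrix.specialUnitaryGroup (Fin 2) ℂ) : Matrix (Fin 2) (Fin 2) ℂ) 0 0 =
      (T : Matrix (Fin 2) (Fin 2) ℂ) 0 0 * (U : Matrix (Fin 2) (Fin 2) ℂ) 0 0 := by
  rw [su2_mul_val_00, hT, zero_mul, sub_zero]

/-- Conjugation by a diagonal `T` FIXES `U₀₀` … [folklore] -/
theorem su2_diag_conj_val_00 {T : Matrix.specialUnitaryGroup (Fin 2) ℂ} (hT : (T : Matrix (Fin 2) (Fin 2) ℂ) 0 1 = 0)
    (U : Matrix.specialUnitaryGroup (Fin 2) ℂ) :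
    ((T * U * T⁻¹ : Matrix.specialUnitaryGroup (Fin 2) ℂ) : Matrix (Fin 2) (Fin 2) ℂ) 0 0 =
      (U : Matrix (Fin 2) (Fin 2) ℂ) 0 0 := by
  rw [su2_mul_val_00, su2_mul_val_00, su2_mul_val_01, su2_inv_val_00, su2_inv_val_01, hT]
  simp only [zero_mul, sub_zero, add_zero, neg_zero, map_zero, mul_zero]
  linear_combination ((U : Matrix (Fin 2) (Fin 2) ℂ) 0 0) * su2_diag_mul_conj hT

/-- … and MULTIPLIES `U₀₁` by `T₀₀²` (so the maximal torus acts transitively on the phases of `U₀₁`). [folklore] -/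
theorem su2_diag_conj_val_01 {T : Matrix.specialUnitaryGroup (Fin 2) ℂ} (hT : (T : Matrix (Fin 2) (Fin 2) ℂ) 0 1 = 0)
    (U : Matrix.specialUnitaryGroup (Fin 2) ℂ) :
    ((T * U * T⁻¹ : Matrix.specialUnitaryGroup (Fin 2) ℂ) : Matrix (Fin 2) (Fin 2) ℂ) 0 1 =
      (T : Matrix (Fin 2) (Fin 2) ℂ) 0 0 ^ 2 * (U : Matrix (Fin 2) (Fin 2) ℂ) 0 1 := by
  rw [su2_mul_val_01, su2_mul_val_00, su2_mul_val_01, su2_inv_val_00, su2_inv_val_01, hT]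
  simp only [zero_mul, sub_zero, add_zero, neg_zero, mul_zero, zero_add, Complex.conj_conj]
  ring

/-- The diagonal torus of `SU(2)` contains a square root of every phase: for `‖ω‖ = 1` there is a diagonal `T` with
`T₀₀² = ω` (`ℂ` is algebraically closed; `T = dPairHom 0 1 τ`, `τ² = ω`). [folklore] -/
theorem su2_exists_diag_sq_eq {ω : ℂ} (hω : ‖ω‖ = 1) : ∃ T : Matrix.specialUnitaryGroup (Fin 2) ℂ,
    (T : Matrix (Fin 2) (Fin 2) ℂ) 0 1 = 0 ∧ (T : Matrix (Fin 2) (Fin 2) ℂ) 0 0 ^ 2 = ω := by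
  obtain ⟨τ, hτ⟩ := IsAlgClosed.exists_pow_nat_eq ω (by norm_num : 0 < 2)
  have hτ1 : ‖τ‖ = 1 := by
    have h : ‖τ‖ ^ 2 = 1 := by rw [← norm_pow, hτ, hω]
    exact (pow_eq_one_iff_of_nonneg (norm_nonneg τ) two_ne_zero).1 h
  refine ⟨dPairHom 0 1 (circleOfNormEqOne τ hτ1), ?_, ?_⟩
  · rw [coe_dPairHom, Matrix.diagonal_apply_ne _ (by decide)]
  · rw [coe_dPairHom, Matrix.diagonal_apply_eq, ← hτ]
    simp [pairFun]

/-! ### D.2  Elementary facts about complex numbers of modulus one -/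

/-- If `Re z = Re z'` and `Re(λz) = Re(λz')` for some `λ` with `Im λ ≠ 0`, then `z = z'`. [folklore] -/
theorem complex_eq_of_re_eq_of_re_mul_eq {l z z' : ℂ} (hl : l.im ≠ 0) (h1 : z.re = z'.re)
    (h2 : (l * z).re = (l * z').re) : z = z' := by
  apply Complex.ext h1
  rw [Complex.mul_re, Complex.mul_re, h1] at h2
  exact mul_left_cancel₀ hl (by linarith)

/-- A complex number of modulus one with `Re λ ≠ ±1` has `Im λ ≠ 0`. [folklore] -/
theorem complex_im_ne_zero_of_normSq_eq_one {l : ℂ} (hl : Complex.normSq l = 1) (h1 : l.re ≠ 1) (h2 : l.re ≠ -1) :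
    l.im ≠ 0 := by
  intro him
  rw [Complex.normSq_apply, him, mul_zero, add_zero] at hl
  rcases mul_self_eq_one_iff.1 hl with h | h
  exacts [h1 h, h2 h]

/-- Two complex numbers of modulus one with the same real part are equal or conjugate. [folklore] -/
theorem complex_eq_or_eq_conj_of_re_eq {l m : ℂ} (hl : Complex.normSq l = 1) (hm : Complex.normSq m = 1)
    (h : l.re = m.re) : m = l ∨ m = (starRingEnd ℂ) l := by
  rw [Complex.normSq_apply] at hl hm
  rw [h] at hl
  have e : m.im * m.im = l.im * l.im := by linarith
  rcases mul_self_eq_mul_self_iff.1 e with h' | h'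
  · exact Or.inl (Complex.ext h.symm h')
  · exact Or.inr (Complex.ext (by rw [Complex.conj_re, h]) (by rw [Complex.conj_im, h']))

/-! ### D.3  Central elements: `Re U₀₀ = ±1` forces `U = ±1` -/

/-- If `Re U₀₀ = ±1` then `U₀₀` is real and `U₀₁ = 0`. [folklore] -/
theorem su2_central_of_re {U : Matrix.specialUnitaryGroup (Fin 2) ℂ}
    (h : ((U : Matrix (Fin 2) (Fin 2) ℂ) 0 0).re = 1 ∨ ((U : Matrix (Fin 2) (Fin 2) ℂ) 0 0).re = -1) :
    (U : Matrix (Fin 2) (Fin 2) ℂ) 0 0 = ((((U : Matrix (Fin 2) (Fin 2) ℂ) 0 0).re : ℝ) : ℂ) ∧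
      (U : Matrix (Fin 2) (Fin 2) ℂ) 0 1 = 0 := by
  have hn := su2_normSq_val00_add_normSq_val01 U
  rw [Complex.normSq_apply ((U : Matrix (Fin 2) (Fin 2) ℂ) 0 0)] at hn
  have hre : ((U : Matrix (Fin 2) (Fin 2) ℂ) 0 0).re * ((U : Matrix (Fin 2) (Fin 2) ℂ) 0 0).re = 1 := by
    rcases h with h | h <;> rw [h] <;> norm_num
  have him2 : ((U : Matrix (Fin 2) (Fin 2) ℂ) 0 0).im * ((U : Matrix (Fin 2) (Fin 2) ℂ) 0 0).im = 0 := by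
    nlinarith [Complex.normSq_nonneg ((U : Matrix (Fin 2) (Fin 2) ℂ) 0 1),
      mul_self_nonneg ((U : Matrix (Fin 2) (Fin 2) ℂ) 0 0).im]
  have hb : Complex.normSq ((U : Matrix (Fin 2) (Fin 2) ℂ) 0 1) = 0 := by
    nlinarith [Complex.normSq_nonneg ((U : Matrix (Fin 2) (Fin 2) ℂ) 0 1),
      mul_self_nonneg ((U : Matrix (Fin 2) (Fin 2) ℂ) 0 0).im]
  exact ⟨Complex.ext (by simp) (by simpa using mul_self_eq_zero.1 him2), Complex.normSq_eq_zero.1 hb⟩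

/-- Hence two elements with `Re U₀₀ = Re U'₀₀ = ±1` are EQUAL (both are the same `±1`). [folklore] -/
theorem su2_eq_of_re_eq_of_central {U U' : Matrix.specialUnitaryGroup (Fin 2) ℂ}
    (hU : ((U : Matrix (Fin 2) (Fin 2) ℂ) 0 0).re = 1 ∨ ((U : Matrix (Fin 2) (Fin 2) ℂ) 0 0).re = -1)
    (h : ((U : Matrix (Fin 2) (Fin 2) ℂ) 0 0).re = ((U' : Matrix (Fin 2) (Fin 2) ℂ) 0 0).re) : U = U' := by
  have hU' : ((U' : Matrix (Fin 2) (Fin 2) ℂ) 0 0).re = 1 ∨ ((U' : Matrix (Fin 2) (Fin 2) ℂ) 0 0).re = -1 := by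
    rwa [h] at hU
  obtain ⟨ha, hb⟩ := su2_central_of_re hU
  obtain ⟨ha', hb'⟩ := su2_central_of_re hU'
  exact su2_ext (by rw [ha, ha', h]) (by rw [hb, hb'])

/-! ### D.4  Diagonal elements and the matching of two diagonalisations with equal trace -/

/-- For a diagonal `D = diag(d₀, d₁) ∈ SU(2)`: `d₁ = conj d₀`. [folklore] -/
theorem su2_diag_snd_eq_conj {D : Matrix.specialUnitaryGroup (Fin 2) ℂ} {dd : Fin 2 → ℂ}
    (hD : (D : Matrix (Fin 2) (Fin 2) ℂ) = Matrix.diagonal dd) : dd 1 = (starRingEnd ℂ) (dd 0) := by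
  have h := prod_eq_one_of_coe_eq_diagonal hD
  rw [Fin.prod_univ_two] at h
  rw [← inv_eq_conj_of_norm_eq_one (norm_eq_one_of_coe_eq_diagonal hD 0)]
  exact (inv_eq_of_mul_eq_one_right h).symm

/-- For a diagonal `D = diag(dd) ∈ SU(2)`: `|dd 0|² = 1`. [folklore] -/
theorem su2_diag_normSq_eq_one {D : Matrix.specialUnitaryGroup (Fin 2) ℂ} {dd : Fin 2 → ℂ}
    (hD : (D : Matrix (Fin 2) (Fin 2) ℂ) = Matrix.diagonal dd) : Complex.normSq (dd 0) = 1 := by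
  rw [Complex.normSq_eq_norm_sq, norm_eq_one_of_coe_eq_diagonal hD 0, one_pow]

/-- **Two diagonal elements of `SU(2)` with the same `Re d₀` are conjugate** (equal, or swapped by the signed
permutation `sSwap 0 1`, since the second eigenvalue is the conjugate of the first). [folklore] -/
theorem su2_exists_conj_diag_eq_diag {D D' : Matrix.specialUnitaryGroup (Fin 2) ℂ} {dd dd' : Fin 2 → ℂ}
    (hD : (D : Matrix (Fin 2) (Fin 2) ℂ) = Matrix.diagonal dd) (hD' : (D' : Matrix (Fin 2) (Fin 2) ℂ) = Matrix.diagonal dd')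
    (hre : (dd 0).re = (dd' 0).re) : ∃ t : Matrix.specialUnitaryGroup (Fin 2) ℂ, t * D' * t⁻¹ = D := by
  rcases complex_eq_or_eq_conj_of_re_eq (su2_diag_normSq_eq_one hD) (su2_diag_normSq_eq_one hD') hre with h | h
  · refine ⟨1, ?_⟩
    rw [one_mul, inv_one, mul_one]
    apply Subtype.ext
    rw [hD, hD', Matrix.diagonal_eq_diagonal_iff]
    intro k
    fin_cases k
    · exact h
    · show dd' 1 = dd 1
      rw [su2_diag_snd_eq_conj hD, su2_diag_snd_eq_conj hD', h]
  · refine ⟨sSwap 0 1, ?_⟩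
    apply Subtype.ext
    rw [coe_sSwap_conj hD', hD, Matrix.diagonal_eq_diagonal_iff]
    intro k
    fin_cases k
    · show dd' (Equiv.swap (0 : Fin 2) 1 0) = dd 0
      rw [Equiv.swap_apply_left, su2_diag_snd_eq_conj hD', h, Complex.conj_conj]
    · show dd' (Equiv.swap (0 : Fin 2) 1 1) = dd 1
      rw [Equiv.swap_apply_right, su2_diag_snd_eq_conj hD, h]

/-- **Two elements of `SU(2)` with the same trace (`Re U₀₀`) are conjugate**, and the conjugators can be chosen to
bring BOTH to the same diagonal `D` (spectral theorem `exists_conj_eq_diagonal` of the tree, then the matching lemma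
above). [folklore] -/
theorem su2_exists_common_diag {x y : Matrix.specialUnitaryGroup (Fin 2) ℂ}
    (h : ((x : Matrix (Fin 2) (Fin 2) ℂ) 0 0).re = ((y : Matrix (Fin 2) (Fin 2) ℂ) 0 0).re) :
    ∃ (u v D : Matrix.specialUnitaryGroup (Fin 2) ℂ), (D : Matrix (Fin 2) (Fin 2) ℂ) 0 1 = 0 ∧
      ((D : Matrix (Fin 2) (Fin 2) ℂ) 0 0).re = ((x : Matrix (Fin 2) (Fin 2) ℂ) 0 0).re ∧
        x = u * D * u⁻¹ ∧ y = v * D * v⁻¹ := by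
  obtain ⟨u, D, dd, hD, hx⟩ := exists_conj_eq_diagonal x
  obtain ⟨u', D', dd', hD', hy⟩ := exists_conj_eq_diagonal y
  -- the traces: `2 Re x₀₀ = tr x = tr D = 2 Re dd 0`, same for `y`
  have htx : ((x : Matrix (Fin 2) (Fin 2) ℂ) 0 0).re = (dd 0).re := by
    have h1 : (x : Matrix (Fin 2) (Fin 2) ℂ).trace = (D : Matrix (Fin 2) (Fin 2) ℂ).trace := by
      rw [hx, Submonoid.coe_mul, Submonoid.coe_mul, Matrix.trace_mul_cycle, ← Submonoid.coe_mul, inv_mul_cancel,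
        OneMemClass.coe_one, one_mul]
    rw [su2_trace, su2_trace, Complex.ofReal_inj, hD, Matrix.diagonal_apply_eq] at h1
    linarith
  have hty : ((y : Matrix (Fin 2) (Fin 2) ℂ) 0 0).re = (dd' 0).re := by
    have h1 : (y : Matrix (Fin 2) (Fin 2) ℂ).trace = (D' : Matrix (Fin 2) (Fin 2) ℂ).trace := by
      rw [hy, Submonoid.coe_mul, Submonoid.coe_mul, Matrix.trace_mul_cycle, ← Submonoid.coe_mul, inv_mul_cancel,
        OneMemClass.coe_one, one_mul]
    rw [su2_trace, su2_trace, Complex.ofReal_inj, hD', Matrix.diagonal_apply_eq] at h1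
    linarith
  obtain ⟨t, ht⟩ := su2_exists_conj_diag_eq_diag hD hD' (by rw [← htx, ← hty, h])
  refine ⟨u, u' * t⁻¹, D, by rw [hD, Matrix.diagonal_apply_ne _ (by decide)], by rw [hD, Matrix.diagonal_apply_eq, htx],
    hx, ?_⟩
  rw [hy, ← ht]
  group

/-! ### D.5  The separation argument -/

/-- From the hypothesis of `TraceWordsSeparateOrbits` for `SU(2)`: `Re w(V)₀₀ = Re w(W)₀₀` for every word. [folklore] -/
theorem su2_re_wordVal_eq {ι : Type*} {V W : ι → Matrix.specialUnitaryGroup (Fin 2) ℂ}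
    (hVW : ∀ (w : List (ι × Bool)) (b : Bool),
      tracePart (fundamentalRep (Fin 2)) b (wordVal w V) = tracePart (fundamentalRep (Fin 2)) b (wordVal w W))
    (w : List (ι × Bool)) :
    (((wordVal w V : Matrix.specialUnitaryGroup (Fin 2) ℂ) : Matrix (Fin 2) (Fin 2) ℂ) 0 0).re =
      (((wordVal w W : Matrix.specialUnitaryGroup (Fin 2) ℂ) : Matrix (Fin 2) (Fin 2) ℂ) 0 0).re := by
  have h := hVW w true
  rw [tracePart_true_su2, tracePart_true_su2] at h
  linarith

/-- The separation hypothesis is invariant under conjugating either tuple. [folklore] -/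
theorem su2_traces_eq_conj {ι : Type*} {V W : ι → Matrix.specialUnitaryGroup (Fin 2) ℂ}
    (hVW : ∀ (w : List (ι × Bool)) (b : Bool),
      tracePart (fundamentalRep (Fin 2)) b (wordVal w V) = tracePart (fundamentalRep (Fin 2)) b (wordVal w W))
    (g h : Matrix.specialUnitaryGroup (Fin 2) ℂ) (w : List (ι × Bool)) (b : Bool) :
    tracePart (fundamentalRep (Fin 2)) b (wordVal w fun i => g * V i * g⁻¹) =
      tracePart (fundamentalRep (Fin 2)) b (wordVal w fun i => h * W i * h⁻¹) := by
  rw [wordVal_conj, wordVal_conj, tracePart_conj, tracePart_conj, hVW]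

/-- **MAIN LEMMA (i)** — if `V i₀ = W i₀ = D` is diagonal non-central (`Im D₀₀ ≠ 0`), the words `[i]` and `[i₀, i]`
force `(V i)₀₀ = (W i)₀₀` for every `i`. [folklore] -/
theorem su2_val00_eq_of_traces {ι : Type*} {V W : ι → Matrix.specialUnitaryGroup (Fin 2) ℂ}
    (hVW : ∀ (w : List (ι × Bool)) (b : Bool),
      tracePart (fundamentalRep (Fin 2)) b (wordVal w V) = tracePart (fundamentalRep (Fin 2)) b (wordVal w W))
    {i₀ : ι} {D : Matrix.specialUnitaryGroup (Fin 2) ℂ} (hV : V i₀ = D) (hW : W i₀ = D)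
    (hD : (D : Matrix (Fin 2) (Fin 2) ℂ) 0 1 = 0) (hl : ((D : Matrix (Fin 2) (Fin 2) ℂ) 0 0).im ≠ 0) (i : ι) :
    ((V i : Matrix.specialUnitaryGroup (Fin 2) ℂ) : Matrix (Fin 2) (Fin 2) ℂ) 0 0 =
      ((W i : Matrix.specialUnitaryGroup (Fin 2) ℂ) : Matrix (Fin 2) (Fin 2) ℂ) 0 0 := by
  have h1 := su2_re_wordVal_eq hVW [(i, true)]
  have h2 := su2_re_wordVal_eq hVW [(i₀, true), (i, true)]
  simp only [wordVal_cons, wordVal_nil, letterVal, mul_one, ite_true] at h1 h2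
  rw [hV, hW, su2_diag_mul_val_00 hD, su2_diag_mul_val_00 hD] at h2
  exact complex_eq_of_re_eq_of_re_mul_eq hl h1 h2

/-- **MAIN LEMMA (ii)** — if moreover `V i₁ = W i₁` has `(V i₁)₀₁ ≠ 0`, the words `[i₁, i]` and `[i₀, i₁, i]` force
`V i = W i` for every `i`. [folklore] -/
theorem su2_eq_of_traces {ι : Type*} {V W : ι → Matrix.specialUnitaryGroup (Fin 2) ℂ}
    (hVW : ∀ (w : List (ι × Bool)) (b : Bool),
      tracePart (fundamentalRep (Fin 2)) b (wordVal w V) = tracePart (fundamentalRep (Fin 2)) b (wordVal w W))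
    {i₀ i₁ : ι} {D : Matrix.specialUnitaryGroup (Fin 2) ℂ} (hV : V i₀ = D) (hW : W i₀ = D)
    (hD : (D : Matrix (Fin 2) (Fin 2) ℂ) 0 1 = 0) (hl : ((D : Matrix (Fin 2) (Fin 2) ℂ) 0 0).im ≠ 0)
    (h1 : V i₁ = W i₁) (hc : ((V i₁ : Matrix.specialUnitaryGroup (Fin 2) ℂ) : Matrix (Fin 2) (Fin 2) ℂ) 0 1 ≠ 0)
    (i : ι) : V i = W i := by
  have ha := su2_val00_eq_of_traces hVW hV hW hD hl
  have e1 := su2_re_wordVal_eq hVW [(i₁, true), (i, true)]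
  have e2 := su2_re_wordVal_eq hVW [(i₀, true), (i₁, true), (i, true)]
  simp only [wordVal_cons, wordVal_nil, letterVal, mul_one, ite_true] at e1 e2
  rw [hV, hW, su2_diag_mul_val_00 hD, su2_diag_mul_val_00 hD] at e2
  have e := complex_eq_of_re_eq_of_re_mul_eq hl e1 e2
  rw [su2_mul_val_00, su2_mul_val_00, ← h1, ha i] at e
  have hconj : (starRingEnd ℂ) (((V i : Matrix.specialUnitaryGroup (Fin 2) ℂ) : Matrix (Fin 2) (Fin 2) ℂ) 0 1) =
      (starRingEnd ℂ) (((W i : Matrix.specialUnitaryGroup (Fin 2) ℂ) : Matrix (Fin 2) (Fin 2) ℂ) 0 1) :=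
    mul_left_cancel₀ hc (by linear_combination -e)
  exact su2_ext (ha i) (by simpa using congrArg (starRingEnd ℂ) hconj)

/-- **THE NORMALISED CASE** — if `V i₀ = W i₀ = D` is diagonal non-central, then `W = T V T⁻¹` for a diagonal `T`.
(If all `(V i)₀₁ = 0` then `V = W` by (i) and `|U₀₀|² + |U₀₁|² = 1`; otherwise pick `i₁` with `(V i₁)₀₁ ≠ 0`, rotate
`V` by the diagonal `T` with `T₀₀² = (W i₁)₀₁ / (V i₁)₀₁` — a phase, the moduli being equal — so that `T V T⁻¹` and
`W` agree at `i₀` AND `i₁`, and apply (ii).) [folklore] -/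
theorem su2_conj_of_traces_normalised {ι : Type*} {V W : ι → Matrix.specialUnitaryGroup (Fin 2) ℂ}
    (hVW : ∀ (w : List (ι × Bool)) (b : Bool),
      tracePart (fundamentalRep (Fin 2)) b (wordVal w V) = tracePart (fundamentalRep (Fin 2)) b (wordVal w W))
    {i₀ : ι} {D : Matrix.specialUnitaryGroup (Fin 2) ℂ} (hV : V i₀ = D) (hW : W i₀ = D)
    (hD : (D : Matrix (Fin 2) (Fin 2) ℂ) 0 1 = 0) (hl : ((D : Matrix (Fin 2) (Fin 2) ℂ) 0 0).im ≠ 0) :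
    ∃ g : Matrix.specialUnitaryGroup (Fin 2) ℂ, ∀ i, W i = g * V i * g⁻¹ := by
  have ha := su2_val00_eq_of_traces hVW hV hW hD hl
  -- equal moduli of the off-diagonal entries
  have hnb : ∀ i, Complex.normSq (((V i : Matrix.specialUnitaryGroup (Fin 2) ℂ) : Matrix (Fin 2) (Fin 2) ℂ) 0 1) =
      Complex.normSq (((W i : Matrix.specialUnitaryGroup (Fin 2) ℂ) : Matrix (Fin 2) (Fin 2) ℂ) 0 1) := by
    intro i
    have hv := su2_normSq_val00_add_normSq_val01 (V i)
    have hw := su2_normSq_val00_add_normSq_val01 (W i)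
    rw [ha i] at hv
    linarith
  by_cases hB : ∀ i, ((V i : Matrix.specialUnitaryGroup (Fin 2) ℂ) : Matrix (Fin 2) (Fin 2) ℂ) 0 1 = 0
  · -- (B1) every `V i` is diagonal: then so is every `W i`, and `V = W`
    refine ⟨1, fun i => ?_⟩
    rw [one_mul, inv_one, mul_one]
    have hw0 : ((W i : Matrix.specialUnitaryGroup (Fin 2) ℂ) : Matrix (Fin 2) (Fin 2) ℂ) 0 1 = 0 := by
      have h := hnb i
      rw [hB i, map_zero] at h
      exact Complex.normSq_eq_zero.1 h.symm
    exact (su2_ext (ha i) (by rw [hB i, hw0])).symm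
  · -- (B2) some `V i₁` is off-diagonal: rotate its phase into place with a diagonal `T`
    simp only [not_forall] at hB
    obtain ⟨i₁, hi₁⟩ := hB
    set bV := ((V i₁ : Matrix.specialUnitaryGroup (Fin 2) ℂ) : Matrix (Fin 2) (Fin 2) ℂ) 0 1 with hbV
    set bW := ((W i₁ : Matrix.specialUnitaryGroup (Fin 2) ℂ) : Matrix (Fin 2) (Fin 2) ℂ) 0 1 with hbW
    have hω : ‖bW / bV‖ = 1 := by
      have h := hnb i₁
      rw [Complex.normSq_eq_norm_sq, Complex.normSq_eq_norm_sq] at h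
      have hn : ‖bV‖ = ‖bW‖ := (pow_left_inj₀ (norm_nonneg _) (norm_nonneg _) two_ne_zero).1 h
      rw [norm_div, ← hn, div_self (norm_ne_zero_iff.2 hi₁)]
    obtain ⟨T, hT01, hT2⟩ := su2_exists_diag_sq_eq hω
    -- the rotated tuple `V' = T V T⁻¹`
    let V' : ι → Matrix.specialUnitaryGroup (Fin 2) ℂ := fun i => T * V i * T⁻¹
    have hV'W : ∀ (w : List (ι × Bool)) (b : Bool),
        tracePart (fundamentalRep (Fin 2)) b (wordVal w V') = tracePart (fundamentalRep (Fin 2)) b (wordVal w W) := by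
      intro w b
      rw [show V' = fun i => T * V i * T⁻¹ from rfl, wordVal_conj, tracePart_conj, hVW]
    have hV'0 : V' i₀ = D := by
      show T * V i₀ * T⁻¹ = D
      rw [hV]
      exact su2_ext (su2_diag_conj_val_00 hT01 D) (by rw [su2_diag_conj_val_01 hT01, hD, mul_zero])
    have hV'1 : V' i₁ = W i₁ := by
      refine su2_ext ?_ ?_
      · show ((T * V i₁ * T⁻¹ : Matrix.specialUnitaryGroup (Fin 2) ℂ) : Matrix (Fin 2) (Fin 2) ℂ) 0 0 = _
        rw [su2_diag_conj_val_00 hT01, ha i₁]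
      · show ((T * V i₁ * T⁻¹ : Matrix.specialUnitaryGroup (Fin 2) ℂ) : Matrix (Fin 2) (Fin 2) ℂ) 0 1 = bW
        rw [su2_diag_conj_val_01 hT01, hT2, ← hbV, div_mul_cancel₀ _ hi₁]
    have hc : ((V' i₁ : Matrix.specialUnitaryGroup (Fin 2) ℂ) : Matrix (Fin 2) (Fin 2) ℂ) 0 1 ≠ 0 := by
      show ((T * V i₁ * T⁻¹ : Matrix.specialUnitaryGroup (Fin 2) ℂ) : Matrix (Fin 2) (Fin 2) ℂ) 0 1 ≠ 0
      rw [su2_diag_conj_val_01 hT01, hT2]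
      exact mul_ne_zero (div_ne_zero (fun h => by
        have := hnb i₁; rw [← hbW, h, map_zero, Complex.normSq_eq_zero] at this; exact hi₁ this) hi₁) hi₁
    have hVW' := su2_eq_of_traces hV'W hV'0 hW hD hl hV'1 hc
    exact ⟨T, fun i => (hVW' i).symm⟩

/-- **THEOREM (orbit separation for `SU(2)`).**  Word traces — indeed the REAL traces of the words of length `≤ 3`
in the letters `i` (no inverses needed) — separate the simultaneous-conjugation orbits of `SU(2)` on `SU(2)^ι`, for
every finite `ι`.  (Case A: every `V i` is central, `Re (V i)₀₀ = ±1` — then `V = W`.  Case B: some `V i₀` is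
non-central — diagonalise `V i₀` and `W i₀` to a COMMON diagonal `D` (same trace), conjugate both tuples accordingly,
and apply the normalised case.)  The invariant-theoretic content is classical (Fricke–Klein–Vogt: the character
variety of the free group in `SL₂` is coordinatised by traces of words of length `≤ 3`; Procesi 1976 for `n`-tuples
of matrices); the statement is the `n = 2` case of Sengupta 1994 Thm 2 in the trace form its proof uses (p.900),
equivalently the `SU(2)`, one-representation case of Lévy 2004 Prop. 3.4 — here with a kernel proof.
[cite: Sengupta1994, Thm 2 p.900] -/
theorem traceWordsSeparateOrbits_su2 : TraceWordsSeparateOrbits (fundamentalRep (Fin 2)) := by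
  intro ι _ V W hVW
  by_cases hA : ∀ i, (((V i : Matrix.specialUnitaryGroup (Fin 2) ℂ) : Matrix (Fin 2) (Fin 2) ℂ) 0 0).re = 1 ∨
      (((V i : Matrix.specialUnitaryGroup (Fin 2) ℂ) : Matrix (Fin 2) (Fin 2) ℂ) 0 0).re = -1
  · -- Case A
    refine ⟨1, fun i => ?_⟩
    rw [one_mul, inv_one, mul_one]
    have h1 := su2_re_wordVal_eq hVW [(i, true)]
    simp only [wordVal_cons, wordVal_nil, letterVal, mul_one, ite_true] at h1
    exact (su2_eq_of_re_eq_of_central (hA i) h1).symm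
  · -- Case B
    simp only [not_forall, not_or] at hA
    obtain ⟨i₀, h1, h2⟩ := hA
    have h0 := su2_re_wordVal_eq hVW [(i₀, true)]
    simp only [wordVal_cons, wordVal_nil, letterVal, mul_one, ite_true] at h0
    obtain ⟨u, v, D, hD01, hDre, hx, hy⟩ := su2_exists_common_diag h0
    have hl : ((D : Matrix (Fin 2) (Fin 2) ℂ) 0 0).im ≠ 0 := by
      refine complex_im_ne_zero_of_normSq_eq_one ?_ (by rw [hDre]; exact h1) (by rw [hDre]; exact h2)
      have h := su2_normSq_val00_add_normSq_val01 D
      rwa [hD01, map_zero, add_zero] at h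
    -- normalise: `V₁ = u⁻¹ V u`, `W₁ = v⁻¹ W v` have `V₁ i₀ = W₁ i₀ = D`
    let V₁ : ι → Matrix.specialUnitaryGroup (Fin 2) ℂ := fun i => u⁻¹ * V i * u⁻¹⁻¹
    let W₁ : ι → Matrix.specialUnitaryGroup (Fin 2) ℂ := fun i => v⁻¹ * W i * v⁻¹⁻¹
    have hV₁ : V₁ i₀ = D := by
      show u⁻¹ * V i₀ * u⁻¹⁻¹ = D
      rw [hx]; group
    have hW₁ : W₁ i₀ = D := by
      show v⁻¹ * W i₀ * v⁻¹⁻¹ = D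
      rw [hy]; group
    obtain ⟨g, hg⟩ := su2_conj_of_traces_normalised (su2_traces_eq_conj hVW u⁻¹ v⁻¹) hV₁ hW₁ hD01 hl
    refine ⟨v * g * u⁻¹, fun i => ?_⟩
    have hgi : v⁻¹ * W i * v⁻¹⁻¹ = g * (u⁻¹ * V i * u⁻¹⁻¹) * g⁻¹ := hg i
    calc W i = v * (v⁻¹ * W i * v⁻¹⁻¹) * v⁻¹ := by group
      _ = v * (g * (u⁻¹ * V i * u⁻¹⁻¹) * g⁻¹) * v⁻¹ := by rw [hgi]
      _ = v * g * u⁻¹ * V i * (v * g * u⁻¹)⁻¹ := by group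

end SU2Orbits


/-! ## PART E — HEADLINES FOR `SU(2)`: `(3a) ⟺ (W-corr) ⟺ (W-single)`, UNCONDITIONALLY -/

section SU2Headlines

variable {d : ℕ}

/-- `SU(n)` is second countable (a subspace of `Matrix n n ℂ = n → n → ℂ`). [folklore] -/
theorem specialUnitaryGroup_secondCountable (n : Type*) [Fintype n] [DecidableEq n] :
    SecondCountableTopology (Matrix.specialUnitaryGroup n ℂ) :=
  haveI : SecondCountableTopology (Matrix n n ℂ) := inferInstanceAs (SecondCountableTopology (n → n → ℂ))
  Topology.IsEmbedding.subtypeVal.secondCountableTopology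

/-- **`SU(2)`: THE SEVERAL-VARIABLE DENSITY SCHEMA OF MODULE XX HOLDS** (orbit separation + Stone–Weierstrass).
[cite: Levy2004, Prop 3.4 p.5] -/
theorem traceWordsDense_su2 : TraceWordsDense (fundamentalRep (Fin 2)) :=
  traceWordsDense_of_traceWordsSeparateOrbits _ (continuous_fundamentalRep (Fin 2)) traceWordsSeparateOrbits_su2

/-- **`SU(2)`: LÉVY'S DENSITY ON `ℤ^d`** — the Wilson-loop products span a dense subspace of the gauge-invariant
cylinder functions, in every dimension `d` (module XX's reduction + `traceWordsDense_su2`).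
[cite: Levy2004, Thm 3.1 p.5] -/
theorem spansGaugeInvariantCylinders_su2 :
    SpansGaugeInvariantCylinders d (wilsonLoopProducts (fundamentalRep (Fin 2)) d) :=
  spansGaugeInvariantCylinders_of_traceWordsDense _ traceWordsDense_su2

/-- **`SU(2)`: ALREADY THE SINGLE WILSON LOOPS SPAN A DENSE SUBSPACE** (Fricke). [cite: Levy2004, Thm 3.1 p.5] -/
theorem spansGaugeInvariantCylinders_loopFactor_su2 :
    SpansGaugeInvariantCylinders d (Set.range (loopFactor (d := d) (fundamentalRep (Fin 2)))) :=
  spansGaugeInvariantCylinders_loopFactor_of_prod _ two_ne_zero tracePart_mul_tracePart_su2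
    spansGaugeInvariantCylinders_su2

/-- **HEADLINE 1 — `SU(2)`: `(3a) ⟺ (W-corr)` UNCONDITIONALLY.**  Four-or-any-dimensional `SU(2)` lattice
Yang–Mills theory at real coupling `β` has a unique infinite-volume limit of its torus states iff every finite
Wilson-loop correlation `⟨∏ Re tr U(ℓᵢ)⟩_{𝕋_{L+1},β}` converges as `L → ∞`.  No density hypothesis remains.
[cite: Levy2004, Thm 3.1 p.5] -/
theorem hasUniqueInfiniteVolumeLimit_iff_hasWilsonLoopCorrelationLimits_su2 (β : ℝ) :
    HasUniqueInfiniteVolumeLimit (d := d) (fundamentalRep (Fin 2)) β ↔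
      HasWilsonLoopCorrelationLimits (fundamentalRep (Fin 2)) d β := by
  haveI := specialUnitaryGroup_secondCountable (Fin 2)
  exact hasUniqueInfiniteVolumeLimit_iff_hasWilsonLoopCorrelationLimits _ (continuous_fundamentalRep (Fin 2)) β
    spansGaugeInvariantCylinders_su2

/-- **HEADLINE 2 — `SU(2)`, SHARPEST FORM: `(3a) ⟺ (W-single)`.**  Uniqueness of the infinite-volume limit of the
torus states iff for every single lattice loop `ℓ` the torus expectation `⟨Re tr U(ℓ)⟩_{𝕋_{L+1},β}` (and the
identically vanishing `⟨Im tr U(ℓ)⟩`) converges as `L → ∞`.  THE EXACT MISSING ESTIMATE for `SU(2)`.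
[cite: Levy2004, Thm 3.1 p.5] -/
theorem hasUniqueInfiniteVolumeLimit_iff_hasWilsonLoopLimits_su2 (β : ℝ) :
    HasUniqueInfiniteVolumeLimit (d := d) (fundamentalRep (Fin 2)) β ↔ HasWilsonLoopLimits (fundamentalRep (Fin 2)) d β := by
  haveI := specialUnitaryGroup_secondCountable (Fin 2)
  exact hasUniqueInfiniteVolumeLimit_iff_hasWilsonLoopLimits_of_spans _ (continuous_fundamentalRep (Fin 2)) β
    spansGaugeInvariantCylinders_loopFactor_su2

/-- Hence for `SU(2)` the two Wilson-loop conditions of modules XIX/XX COINCIDE: `(W-corr) ⟺ (W-single)`.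
[folklore] -/
theorem hasWilsonLoopCorrelationLimits_iff_hasWilsonLoopLimits_su2 (β : ℝ) :
    HasWilsonLoopCorrelationLimits (fundamentalRep (Fin 2)) d β ↔ HasWilsonLoopLimits (fundamentalRep (Fin 2)) d β := by
  rw [← hasUniqueInfiniteVolumeLimit_iff_hasWilsonLoopCorrelationLimits_su2,
    hasUniqueInfiniteVolumeLimit_iff_hasWilsonLoopLimits_su2]

/-- The `Im tr` generators vanish identically for `SU(2)`. [folklore] -/
theorem loopFactor_false_su2 (ℓ : Σ x : (Fin d → ℤ), (zdGraph d).Walk x x) :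
    loopFactor (fundamentalRep (Fin 2)) (ℓ, false) = fun _ => 0 := by
  funext U
  rw [loopFactor_eq_tracePart, tracePart_false_su2]

/-- **HEADLINE 3 — CAUCHY FORM.**  `SU(2)` lattice Yang–Mills in dimension `d` at coupling `β` has a unique
infinite-volume limit of its torus states IFF for every lattice loop `ℓ` the real sequence
`L ↦ ⟨Re tr U(ℓ)⟩_{𝕋_{L+1},β}` is CAUCHY.  (The `Im tr` loops are dropped: they vanish.)  This is the precise form
of "the missing volume-uniformity estimate" for `SU(2)`: not a bound uniform in `L` (those exist), but convergence
in `L` of each single Wilson-loop expectation. [folklore] -/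
theorem hasUniqueInfiniteVolumeLimit_su2_iff_cauchySeq (β : ℝ) :
    HasUniqueInfiniteVolumeLimit (d := d) (fundamentalRep (Fin 2)) β ↔
      ∀ ℓ : Σ x : (Fin d → ℤ), (zdGraph d).Walk x x,
        CauchySeq fun L : ℕ => wilsonExpectation (L := L + 1) (fundamentalRep (Fin 2)) β
          (toTorusObservable (L + 1) (loopFactor (fundamentalRep (Fin 2)) (ℓ, true))) := by
  rw [hasUniqueInfiniteVolumeLimit_iff_hasWilsonLoopLimits_su2]
  constructor
  · intro h ℓ
    obtain ⟨_, hℓ⟩ := h (ℓ, true)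
    exact hℓ.cauchySeq
  · rintro h ⟨ℓ, _ | _⟩
    · refine ⟨0, ?_⟩
      have h0 : (fun L : ℕ => wilsonExpectation (L := L + 1) (fundamentalRep (Fin 2)) β
          (toTorusObservable (L + 1) (loopFactor (fundamentalRep (Fin 2)) (ℓ, false)))) = fun _ => 0 := by
        funext L
        rw [loopFactor_false_su2]
        simp [wilsonExpectation, toTorusObservable]
      rw [h0]
      exact tendsto_const_nhds
    · exact cauchySeq_tendsto_of_complete (h ℓ)

end SU2Headlines

/-! ## PART F — CENSUS NEGATIVE: ORBIT SEPARATION IS NOT AUTOMATIC (THE REAL REPRESENTATION OF `U(1)`) -/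

section Negatives

/-- The real representation `so2Rep` of `U(1)` (module XX) is continuous. [folklore] -/
theorem continuous_so2Rep : Continuous so2Rep := by
  have hre : Continuous fun z : Circle => (((z : ℂ).re : ℝ) : ℂ) :=
    Complex.continuous_ofReal.comp (Complex.continuous_re.comp continuous_subtype_val)
  have him : Continuous fun z : Circle => (((z : ℂ).im : ℝ) : ℂ) :=
    Complex.continuous_ofReal.comp (Complex.continuous_im.comp continuous_subtype_val)
  refine continuous_matrix fun i j => ?_
  fin_cases i <;> fin_cases j
  · simpa [so2Rep_apply] using hre
  · convert him.neg using 1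
    funext z
    simp [so2Rep_apply]
  · simpa [so2Rep_apply] using him
  · simpa [so2Rep_apply] using hre

/-- **CENSUS NEGATIVE — the orbit-separation schema FAILS for the faithful real representation of `U(1)`**
(contrapositive of PART C through module XX's `not_traceWordsDense_so2Rep`; directly: `z` and `z⁻¹` have the same
word traces `2 Re zⁿ` but are not conjugate in the abelian group `U(1)` unless `z = ±1`).  So neither faithfulness
nor injectivity of `ρ` is the right hypothesis; separation of ORBITS by word traces is. [cite: Levy2004, §5 p.7] -/
theorem not_traceWordsSeparateOrbits_so2Rep : ¬ TraceWordsSeparateOrbits so2Rep := fun h =>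
  not_traceWordsDense_so2Rep (traceWordsDense_of_traceWordsSeparateOrbits so2Rep continuous_so2Rep h)

end Negatives

end Literature.MathematicalPhysics.QuantumFieldTheory
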